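import Summits.Ventures.PackingBounds.Energy.CircleEnergyLP
import Summits.Ventures.PackingBounds.Energy.ChebyshevTExplicit
import Literature.Analysis.Calculus.AbsolutelyMonotonePowerSeries

/-!
# Universal optimality of the regular pentagon (5 points on `S¹`) — Cohn–Kumar 2007, Table 1, row 1

Framing: lottery ticket; floor = certified bounds/negative ranges. Venture `PackingBounds` (cell
`pub-packcert`, seat `pub-packcert-energy`), energy-minimisation family, `n = 2` via the Chebyshev
LP bound (`CircleEnergyLP.lean`); nodes `cos 144° = (-1-√5)/4`, `cos 72° = (√5-1)/4` in `ℚ(√5)`.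

**Theorems.** Every configuration of `5` unit vectors of `ℝ²` has, for every `k`, `Σ_{x ≠ y} (1 +
⟨x,y⟩)^k ≥ 5 (2 (1 + cos 144°)^k + 2 (1 + cos 72°)^k)` (the regular pentagon's value), hence `Σ_{x ≠
y} a(⟨x,y⟩) ≥ 5 (2 a(cos 144°) + 2 a(cos 72°))` for every power series `a = Σ c_k (1+t)^k`, `c_k ≥
0`, and for every `a` with `AbsolutelyMonotoneOn a (Set.Ico (-1) 1)`. Certificate over `ℚ(√5)`:
Chebyshev table of the four Newton partial products (all entries `≥ 0`, decided with `2.236 < √5 <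
2.237`), identities by `linear_combination e · (√5² = 5)`; the pentagon is a 4-design.

## References
* H. Cohn, A. Kumar, *Universally optimal distribution of points on spheres*, J. Amer. Math. Soc.
  20 (2007) 99–148, Thm. 1.2, Table 1. [`CohnKumar2006`] -/

noncomputable section

namespace Summit.Ventures.PackingBounds.Energy

open Finset Polynomial.Chebyshev Literature.Analysis.Calculus

namespace UniversalPolygon5

/-- `2.236 < √5 < 2.237` and `(√5)² = 5`. [folklore] -/
private theorem sqrt5_facts :
    Real.sqrt 5 ^ 2 = 5 ∧ (2236 / 1000 : ℝ) < Real.sqrt 5 ∧ Real.sqrt 5 < 2237 / 1000 := by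
  refine ⟨Real.sq_sqrt (by norm_num), ?_, ?_⟩
  · rw [show (2236 / 1000 : ℝ) = Real.sqrt ((2236 / 1000) ^ 2) by
      rw [Real.sqrt_sq (by norm_num)]]
    exact Real.sqrt_lt_sqrt (by norm_num) (by norm_num)
  · rw [show (2237 / 1000 : ℝ) = Real.sqrt ((2237 / 1000) ^ 2) by
      rw [Real.sqrt_sq (by norm_num)]]
    exact Real.sqrt_lt_sqrt (by norm_num) (by norm_num)

open scoped Classical in
/-- **Theorem A** (regular pentagon, all `k`). [cite: CohnKumar2006, Theorem 1.2 and Table 1] -/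
theorem ckPow_energy_ge (k : ℕ) (C : Finset (EuclideanSpace ℝ (Fin 2)))
    (h1 : ∀ x ∈ C, ‖x‖ = 1) (hN : C.card = 5) :
    (5 : ℝ) * (2 * (1 + ((-1 / 4 : ℝ) + (-1 / 4 : ℝ) * Real.sqrt 5)) ^ k + 2 * (1 + ((-1 / 4 : ℝ) + (1 / 4 : ℝ) * Real.sqrt 5)) ^ k) ≤
      ∑ x ∈ C, ∑ y ∈ C.erase x, (1 + inner ℝ x y) ^ k := by
  obtain ⟨h5, hlo, hhi⟩ := sqrt5_facts
  refine le_trans (le_of_eq ?val) (NewtonCert.energy_ge_circle 4 (by norm_num)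
    (fun i : ℕ => match i with
      | 0 => ((3 / 4 : ℝ) + (-1 / 4 : ℝ) * Real.sqrt 5 : ℝ) | 1 => (3 / 4 : ℝ) + (1 / 4 : ℝ) * Real.sqrt 5 | 2 => (3 / 4 : ℝ) + (-1 / 4 : ℝ) * Real.sqrt 5
      | 3 => (3 / 4 : ℝ) + (1 / 4 : ℝ) * Real.sqrt 5 | _ => 0)
    ?hv ?hsq
    (fun j i : ℕ => match j with
      | 0 => (match i with | 0 => ((1 : ℝ) : ℝ) | _ => 0)
      | 1 => (match i with | 0 => ((1 / 4 : ℝ) + (1 / 4 : ℝ) * Real.sqrt 5 : ℝ) | 1 => (1 : ℝ) | _ => 0)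
      | 2 => (match i with | 0 => ((1 / 4 : ℝ) : ℝ) | 1 => (1 / 2 : ℝ) | 2 => (1 / 2 : ℝ) | _ => 0)
      | 3 => (match i with | 0 => ((5 / 16 : ℝ) + (1 / 16 : ℝ) * Real.sqrt 5 : ℝ) | 1 => (5 / 8 : ℝ) + (1 / 8 : ℝ) * Real.sqrt 5 | 2 => (3 / 8 : ℝ) + (1 / 8 : ℝ) * Real.sqrt 5 | 3 => (1 / 4 : ℝ) | _ => 0)
      | _ => 0)
    ?hG ?hGid 5 2 (by norm_num)
    (fun i : ℕ => match i with | 0 => (2 : ℝ) | 1 => 2 | _ => 0)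
    ?hdes k C h1 hN)
  case hv => intro i; split <;> nlinarith [hlo, hhi]
  case hsq =>
    exact fun u _ => NewtonCert.omega_doubled_nonneg _ 2 (fun i hi => by
      interval_cases i <;> norm_num) u
  case hG =>
    intro j i
    split <;> (first | (split <;> nlinarith [hlo, hhi]) | norm_num)
  case hGid =>
    intro j hj t
    interval_cases j
    · simp only [Finset.prod_range_zero, Finset.sum_range_succ, Finset.sum_range_zero, Nat.cast_zero, Nat.cast_one, Nat.cast_ofNat, ChebyshevT.t0, ChebyshevT.t1, ChebyshevT.t2, ChebyshevT.t3]
      linear_combination ((0 : ℝ)) * h5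
    · simp only [Finset.prod_range_succ, Finset.prod_range_zero, Finset.sum_range_succ,
        Finset.sum_range_zero, Nat.cast_zero, Nat.cast_one, Nat.cast_ofNat, ChebyshevT.t0, ChebyshevT.t1, ChebyshevT.t2, ChebyshevT.t3]
      linear_combination ((0 : ℝ)) * h5
    · simp only [Finset.prod_range_succ, Finset.prod_range_zero, Finset.sum_range_succ,
        Finset.sum_range_zero, Nat.cast_zero, Nat.cast_one, Nat.cast_ofNat, ChebyshevT.t0, ChebyshevT.t1, ChebyshevT.t2, ChebyshevT.t3]
      linear_combination ((-1 / 16 : ℝ)) * h5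
    · simp only [Finset.prod_range_succ, Finset.prod_range_zero, Finset.sum_range_succ,
        Finset.sum_range_zero, Nat.cast_zero, Nat.cast_one, Nat.cast_ofNat, ChebyshevT.t0, ChebyshevT.t1, ChebyshevT.t2, ChebyshevT.t3]
      linear_combination ((-1 / 64 : ℝ) + (-1 / 16 : ℝ) * t + (-1 / 64 : ℝ) * Real.sqrt 5) * h5
  case hdes =>
    intro j hj
    interval_cases j
    · simp only [Finset.prod_range_zero, Finset.sum_range_succ, Finset.sum_range_zero]
      linear_combination ((0 : ℝ)) * h5
    · simp only [Finset.prod_range_succ, Finset.prod_range_zero, Finset.sum_range_succ,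
        Finset.sum_range_zero]
      linear_combination ((0 : ℝ)) * h5
    · simp only [Finset.prod_range_succ, Finset.prod_range_zero, Finset.sum_range_succ,
        Finset.sum_range_zero]
      linear_combination ((1 / 16 : ℝ)) * h5
    · simp only [Finset.prod_range_succ, Finset.prod_range_zero, Finset.sum_range_succ,
        Finset.sum_range_zero]
      linear_combination ((5 / 64 : ℝ) + (1 / 64 : ℝ) * Real.sqrt 5) * h5
  case val =>
    simp only [Finset.sum_range_succ, Finset.sum_range_zero]
    push_cast
    ring

open scoped Classical in
/-- **Theorem B** (regular pentagon, power-series potentials). [cite: CohnKumar2006, Theorem 1.2] -/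
theorem universally_optimal (a : ℝ → ℝ) (c : ℕ → ℝ) (hc : ∀ k, 0 ≤ c k)
    (ha : ∀ s : ℝ, -1 ≤ s → s < 1 → HasSum (fun k => c k * (1 + s) ^ k) (a s))
    (C : Finset (EuclideanSpace ℝ (Fin 2))) (h1 : ∀ x ∈ C, ‖x‖ = 1) (hN : C.card = 5) :
    (5 : ℝ) * (2 * a ((-1 / 4 : ℝ) + (-1 / 4 : ℝ) * Real.sqrt 5) + 2 * a ((-1 / 4 : ℝ) + (1 / 4 : ℝ) * Real.sqrt 5)) ≤
      ∑ x ∈ C, ∑ y ∈ C.erase x, a (inner ℝ x y) := by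
  obtain ⟨_, hlo, hhi⟩ := sqrt5_facts
  have key := NewtonCert.energy_ge_hasSum_of_pow (n := 2) 5 2
    (fun i : ℕ => match i with | 0 => ((-1 / 4 : ℝ) + (-1 / 4 : ℝ) * Real.sqrt 5 : ℝ) | 1 => (-1 / 4 : ℝ) + (1 / 4 : ℝ) * Real.sqrt 5 | _ => 0)
    (fun i : ℕ => match i with | 0 => (2 : ℝ) | 1 => 2 | _ => 0)
    (fun i hi => by interval_cases i <;> constructor <;> norm_num <;> nlinarith [hlo, hhi]) C h1
    (fun k => by
      refine le_trans (le_of_eq ?_) (ckPow_energy_ge k C h1 hN)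
      simp only [Finset.sum_range_succ, Finset.sum_range_zero]
      push_cast
      ring)
    a c hc ha
  refine le_trans (le_of_eq ?_) key
  simp only [Finset.sum_range_succ, Finset.sum_range_zero]
  push_cast
  ring

open scoped Classical in
/-- **Theorem C** (regular pentagon, Cohn–Kumar Thm. 1.2 verbatim): for every `a` absolutely
monotonic on `[-1,1)`, every `5`-point configuration of unit vectors of `ℝ²` has `a`-energy at least
`5 (2 a(cos 144°) + 2 a(cos 72°))`. [cite: CohnKumar2006, Theorem 1.2] -/
theorem universallyOptimal_of_absolutelyMonotoneOn (a : ℝ → ℝ)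
    (ha : AbsolutelyMonotoneOn a (Set.Ico (-1) 1))
    (C : Finset (EuclideanSpace ℝ (Fin 2))) (h1 : ∀ x ∈ C, ‖x‖ = 1) (hN : C.card = 5) :
    (5 : ℝ) * (2 * a ((-1 / 4 : ℝ) + (-1 / 4 : ℝ) * Real.sqrt 5) + 2 * a ((-1 / 4 : ℝ) + (1 / 4 : ℝ) * Real.sqrt 5)) ≤
      ∑ x ∈ C, ∑ y ∈ C.erase x, a (inner ℝ x y) := by
  obtain ⟨c, hc, hsum⟩ := absolutelyMonotoneOn_hasSum_one_add ha
  exact universally_optimal a c hc hsum C h1 hN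

end UniversalPolygon5

end Summit.Ventures.PackingBounds.Energy

end
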